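import Summits.CriticalPhenomena.PercolationContinuityZ3.Theorems.PercNearOneGluingNoHeavyRsw3AnnulusBKCovering
import Summits.CriticalPhenomena.PercolationContinuityZ3.Theorems.PercNearOneGluingNoHeavyRsw3OneArmHarrisMargin
import Literature.Probability.Percolation.SharpnessDCTProofs
import Mathlib.Analysis.SpecialFunctions.Exp
import HarnessLib

/-!
# RSW3 lane (P2, method "3D RSW-lite from continuity"): the one-arm ENVELOPE of the annulus crossing
# and a finite-size characterisation of the subcritical phase at every aspect ratio

builds on p205010 (kernel theorem, internal audit signed; external expert review pending)

Cell `prim-rsw3` (post-continuity programme, LANE 3 "box crossing / quasi-multiplicativity at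
`p_c(ℤ³)`"), prover seat `prim-rsw3-p2` (gen 2), memo `run/shared/lean/prim/rsw3/P2-RSWLITE.md` §7c.
Support file (`--supports stmt-CriticalPhenomena-4575`); no definitions, no named facts, no sorries.

With `u_p(L,N) = P_p(boxCrossing d L N) = P_p(Λ(L) ↔ ∂ⁱⁿΛ(N) in Λ(N))` and `π_p(n) = oneArmProb d p n`:

* `real_boxCrossing_le_card_mul_oneArmProb` — **one-arm envelope (all `p`, all `d`)**: for `L < N`,
  `u_p(L,N) ≤ (2L+1)^d · π_p(N-L-1)` (union bound over the starting site; the path from `x ∈ Λ(L)` to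
  `∂ⁱⁿΛ(N)` leaves `x + Λ(N-L-1)`; translation invariance).  With the tree's lower bounds this brackets
  the critical window: `(2d)^{-1/2}(L/16N)^{(d-1)/2} ≤ u_{p_c}(L,N) ≤ (2L+1)^d π_{p_c}(N-L-1)`
  (`…Rsw3AnnulusSqrtWindow`; the right side `→ 0` by `θ(p_c) = 0`, p205010, and explicitly by LANE 1's
  `Quant.oneArm_explicit_rate_elementary`, `d ≥ 3`).
* `lt_criticalProb_iff_exists_real_boxCrossing_lt` — **finite-size characterisation of the subcritical
  phase (`d ≥ 2`)**: `p < p_c(ℤ^d)` **iff** `2d (4N/L)^{d-1} · u_p(L,N) < 1` for SOME pair `1 ≤ L ≤ N`.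
  (⇐) is the every-aspect finite-size criterion `Rsw3.theta_eq_zero_of_real_boxCrossing_lt` plus the
  openness of the strict inequality in `p`; (⇒) is sharpness of the phase transition
  (`DCT16.perc_sharpness_holds`: exponential decay of `π_p` below `p_c`, Menshikov 1986 / Aizenman–Barsky 1987 /
  Duminil-Copin–Tassion 2016, tree) fed through the one-arm envelope at `L = 1`.  This is Kesten's
  `p_S = p_T (= p_H)` (1982, Cor. 5.1) with sponge crossings replaced by the annulus events of the lane
  and the aspect ratio free: the critical point is the unique parameter at which NO annulus, of any
  aspect ratio and scale, is crossed with probability below `(2d)⁻¹ (L/4N)^{d-1}`, while (θ(p_c) = 0)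
  every annulus of large enough aspect ratio is crossed with probability as small as desired.

References: H. Kesten, *Percolation Theory for Mathematicians* (1982), Thm. 5.1, Cor. 5.1;
M. V. Menshikov, Soviet Math. Dokl. 33 (1986); M. Aizenman, D. Barsky, Comm. Math. Phys. 108 (1987);
H. Duminil-Copin, V. Tassion, Comm. Math. Phys. 343 (2016) Thm. 1.1. [folklore]
-/

noncomputable section

namespace Summit.CriticalPhenomena.PercolationContinuityZ3.Theorems

open MeasureTheory ProbabilityTheory Filter Topology
open Literature.Probability.Percolation Literature.Probability.LatticeModels
open Literature.Probability.Percolation.CerfDembinVanishing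

namespace Rsw3

open SurfaceTension

variable {d : ℕ}

/-! ## The one-arm envelope -/

/-- **Covering by shifted one-arm events.** For `L < N`, an open path from `x ∈ Λ(L)` to `∂ⁱⁿΛ(N)`
inside `Λ(N)` leaves the box `x + Λ(N-L-1)`. -/
theorem boxCrossing_subset_biUnion_shifted_oneArm {L N : ℕ} (hLN : L < N) :
    boxCrossing d L N ⊆ ⋃ x ∈ box d L,
      linked (sbox x (N - L - 1)) ((zdShiftIso x) '' ↑(innerBoundary (zdGraph d) (box d (N - L - 1))))
        (sbox x 0) := by
  intro ω hω
  set M := N - L - 1 with hM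
  rw [boxCrossing_eq_linked, mem_linked_iff] at hω
  obtain ⟨b, hb, a, ha, hab⟩ := hω
  rw [Finset.mem_coe] at ha hb
  obtain ⟨i₀, hi₀⟩ := exists_eq_of_mem_innerBoundary_box hb
  set H := openGraph ω ⊓ withinGraph (zdGraph d) (↑(box d N) : Set (Site d)) with hHdef
  have hH : H ≤ zdGraph d := inf_le_right.trans (withinGraph_le _ _)
  have hreach : H.Reachable a b := by
    rw [inConn_comm, mem_inConn_iff] at hab; exact hab
  obtain ⟨W⟩ := hreach
  have ha0 : a ∈ sbox a 0 := by
    rw [mem_sbox_iff]; intro i; simp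
  have haM : a ∈ sbox a M := sbox_mono a (Nat.zero_le M) ha0
  have hbM : b ∉ sbox a M := by
    intro h
    have h' := (mem_sbox_iff.1 h) i₀
    have hai := (mem_box.1 ha) i₀
    have hMR : (M : ℤ) = N - L - 1 := by rw [hM]; omega
    rcases hi₀ with h0 | h0 <;> rw [h0] at h' <;> [linarith [h'.2, hai.2]; linarith [h'.1, hai.1]]
  obtain ⟨e, e', he, he', hee', hr⟩ := exists_exit_of_walk hH (sbox a M) W haM hbM
  refine Set.mem_iUnion₂.2 ⟨a, ha, ?_⟩
  rw [mem_linked_iff]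
  refine ⟨e, ?_, a, ha0, ?_⟩
  · refine ⟨e - a, ?_, by simp [zdShiftIso_apply]⟩
    rw [Finset.mem_coe, mem_innerBoundary_iff]
    have hbox : e - a ∈ box d M := by
      rw [mem_box]; intro j; simpa only [Pi.sub_apply] using (mem_sbox_iff.1 he) j
    refine ⟨hbox, e' - a, fun he2 => he' ?_, ?_⟩
    · rw [mem_sbox_iff]; intro j; simpa only [Pi.sub_apply] using (mem_box.1 he2) j
    · have hG : (zdGraph d).Adj e e' := hH hee'
      rw [← zdGraph_adj_shift_iff a, Site.shift_apply, Site.shift_apply, sub_add_cancel,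
        sub_add_cancel]
      exact hG
  · rw [mem_inConn_iff]
    exact (hr.mono (le_inf (inf_le_left.trans inf_le_left) inf_le_right)).symm

/-- **One-arm envelope (all `p`, all `d`).** For `L < N`: `u_p(L,N) ≤ (2L+1)^d · π_p(N-L-1)`. -/
theorem real_boxCrossing_le_card_mul_oneArmProb (p : unitInterval) {L N : ℕ} (hLN : L < N) :
    (bondPercolation (zdGraph d) p).real (boxCrossing d L N) ≤
      (2 * (L : ℝ) + 1) ^ d * oneArmProb d p (N - L - 1) := by
  classical
  set μ := bondPercolation (zdGraph d) p with hμ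
  set M := N - L - 1 with hM
  have hterm : ∀ x ∈ box d L, μ.real
      (linked (sbox x M) ((zdShiftIso x) '' ↑(innerBoundary (zdGraph d) (box d M))) (sbox x 0)) =
      oneArmProb d p M := by
    intro x _
    rw [hμ, real_sCrossAt_eq, real_boxCrossing_zero_eq_oneArmProb]
  calc μ.real (boxCrossing d L N)
      ≤ μ.real (⋃ x ∈ box d L,
          linked (sbox x M) ((zdShiftIso x) '' ↑(innerBoundary (zdGraph d) (box d M))) (sbox x 0)) :=
        measureReal_mono (boxCrossing_subset_biUnion_shifted_oneArm hLN) (measure_ne_top _ _)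
    _ ≤ ∑ x ∈ box d L, μ.real
          (linked (sbox x M) ((zdShiftIso x) '' ↑(innerBoundary (zdGraph d) (box d M))) (sbox x 0)) :=
        measureReal_biUnion_finset_le _ _
    _ = ∑ _x ∈ box d L, oneArmProb d p M := Finset.sum_congr rfl hterm
    _ = (2 * (L : ℝ) + 1) ^ d * oneArmProb d p M := by
        rw [Finset.sum_const, nsmul_eq_mul, card_box]; push_cast; ring

/-! ## The subcritical phase is characterised by the every-aspect finite-size criterion -/

/-- Below `p_c` the criterion quantity at `L = 1` tends to `0`: `2d (4N)^{d-1} · 3^d · π_p(N-2) → 0`. -/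
theorem tendsto_criterion_of_lt_criticalProb (hd : 2 ≤ d) (p : unitInterval)
    (hp : (p : ℝ) < criticalProb (zdGraph d) 0) :
    Tendsto (fun N : ℕ => 2 * d * (4 * (N : ℝ) / 1) ^ (d - 1) *
      (bondPercolation (zdGraph d) p).real (boxCrossing d 1 N)) atTop (𝓝 0) := by
  obtain ⟨c, hc, hdecay⟩ := DCT16.perc_sharpness_holds hd p hp
  -- the comparison sequence `A · ((c N)^{d-1} e^{-c N})`, `A = 2d 4^{d-1} 3^d e^{2c} c^{-(d-1)}`
  set A : ℝ := 2 * d * 4 ^ (d - 1) * 3 ^ d * Real.exp (2 * c) * (c⁻¹) ^ (d - 1) with hA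
  have hA0 : 0 ≤ A := by positivity
  have hlim : Tendsto (fun N : ℕ => A * ((c * N) ^ (d - 1) * Real.exp (-(c * N)))) atTop (𝓝 0) := by
    have h1 : Tendsto (fun x : ℝ => x ^ (d - 1) * Real.exp (-x)) atTop (𝓝 0) :=
      Real.tendsto_pow_mul_exp_neg_atTop_nhds_zero (d - 1)
    have h2 : Tendsto (fun N : ℕ => c * (N : ℝ)) atTop atTop :=
      (tendsto_natCast_atTop_atTop).const_mul_atTop hc
    simpa using (h1.comp h2).const_mul A
  -- domination, eventually (for `N ≥ 2`)
  refine squeeze_zero_norm' ?_ hlim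
  filter_upwards [eventually_ge_atTop 2] with N hN
  have hN2 : ((N - 1 - 1 : ℕ) : ℝ) = N - 2 := by
    rw [show N - 1 - 1 = N - 2 by omega]; push_cast [Nat.cast_sub hN]; ring
  have hu : (bondPercolation (zdGraph d) p).real (boxCrossing d 1 N) ≤
      3 ^ d * Real.exp (-(c * (N - 2))) := by
    have h := real_boxCrossing_le_card_mul_oneArmProb (d := d) p (L := 1) (N := N) (by omega)
    have hπ : oneArmProb d p (N - 1 - 1) ≤ Real.exp (-c * ((N - 1 - 1 : ℕ) : ℝ)) := hdecay (N - 1 - 1)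
    rw [hN2] at hπ
    calc (bondPercolation (zdGraph d) p).real (boxCrossing d 1 N)
        ≤ (2 * ((1 : ℕ) : ℝ) + 1) ^ d * oneArmProb d p (N - 1 - 1) := h
      _ ≤ (2 * ((1 : ℕ) : ℝ) + 1) ^ d * Real.exp (-c * ((N : ℝ) - 2)) :=
          mul_le_mul_of_nonneg_left hπ (by positivity)
      _ = 3 ^ d * Real.exp (-(c * (N - 2))) := by norm_num
  have hnonneg : 0 ≤ 2 * d * (4 * (N : ℝ) / 1) ^ (d - 1) *
      (bondPercolation (zdGraph d) p).real (boxCrossing d 1 N) := by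
    have := measureReal_nonneg (μ := bondPercolation (zdGraph d) p) (s := boxCrossing d 1 N)
    positivity
  rw [Real.norm_of_nonneg hnonneg]
  have hkey : 2 * d * (4 * (N : ℝ) / 1) ^ (d - 1) * (3 ^ d * Real.exp (-(c * (N - 2)))) =
      A * ((c * N) ^ (d - 1) * Real.exp (-(c * N))) := by
    rw [hA]
    have hc0 : c ≠ 0 := hc.ne'
    have hexp : Real.exp (-(c * ((N : ℝ) - 2))) = Real.exp (2 * c) * Real.exp (-(c * N)) := by
      rw [← Real.exp_add]; ring_nf
    rw [hexp, div_one, mul_pow, mul_pow, inv_pow]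
    field_simp
  calc 2 * d * (4 * (N : ℝ) / 1) ^ (d - 1) * (bondPercolation (zdGraph d) p).real (boxCrossing d 1 N)
      ≤ 2 * d * (4 * (N : ℝ) / 1) ^ (d - 1) * (3 ^ d * Real.exp (-(c * (N - 2)))) :=
        mul_le_mul_of_nonneg_left hu (by positivity)
    _ = A * ((c * N) ^ (d - 1) * Real.exp (-(c * N))) := hkey

/-- **The subcritical phase, characterised at every aspect ratio (`d ≥ 2`).**
`p < p_c(ℤ^d)` iff for SOME pair `1 ≤ L ≤ N` the annulus `Λ(N) ∖ Λ(L)` is crossed with probability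
`< (2d)⁻¹ (L/4N)^{d-1}`, i.e. `2d (4N/L)^{d-1} · P_p(Λ(L) ↔ ∂ⁱⁿΛ(N) in Λ(N)) < 1`.
[cite: Kesten1982, Thm. 5.1 and Cor. 5.1] -/
theorem lt_criticalProb_iff_exists_real_boxCrossing_lt (hd : 2 ≤ d) (p : unitInterval) :
    (p : ℝ) < criticalProb (zdGraph d) 0 ↔
      ∃ L N : ℕ, 1 ≤ L ∧ L ≤ N ∧ 2 * d * (4 * (N : ℝ) / L) ^ (d - 1) *
        (bondPercolation (zdGraph d) p).real (boxCrossing d L N) < 1 := by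
  constructor
  · intro hp
    have hev := (tendsto_criterion_of_lt_criticalProb hd p hp).eventually (gt_mem_nhds zero_lt_one)
    obtain ⟨N, hN⟩ := (hev.and (eventually_ge_atTop 1)).exists
    refine ⟨1, N, le_rfl, hN.2, ?_⟩
    simpa using hN.1
  · rintro ⟨L, N, hL, hLN, h⟩
    set C : ℝ := 2 * d * (4 * (N : ℝ) / L) ^ (d - 1) with hC
    by_contra hge
    push Not at hge
    rcases hge.lt_or_eq with hlt | heq
    · -- `p_c < p`: `θ(p) > 0`, but the criterion gives `θ(p) = 0`
      have hθ0 := theta_eq_zero_of_real_boxCrossing_lt p hL hLN h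
      have hθpos := theta_pos_of_criticalProb_lt_holds (zdGraph d) 0 p hlt
      linarith
    · -- `p = p_c < 1`: the strict inequality survives slightly above `p`
      have hpc1 : criticalProb (zdGraph d) (0 : Site d) < 1 := criticalProb_zd_lt_one hd
      have hcont : Continuous fun q : unitInterval =>
          C * (bondPercolation (zdGraph d) q).real (boxCrossing d L N) :=
        continuous_const.mul (continuous_real_boxCrossing L N)
      obtain ⟨δ, hδ, hball⟩ := Metric.continuous_iff.1 hcont p
        (1 - C * (bondPercolation (zdGraph d) p).real (boxCrossing d L N)) (by linarith)
      set t : ℝ := min ((p : ℝ) + δ / 2) 1 with ht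
      have hp0 : 0 ≤ (p : ℝ) := p.2.1
      have htI : t ∈ Set.Icc (0 : ℝ) 1 := ⟨le_min (by linarith) zero_le_one, min_le_right _ _⟩
      obtain ⟨q, hq⟩ : ∃ q : unitInterval, (q : ℝ) = t := ⟨⟨t, htI⟩, rfl⟩
      have hlt' : (p : ℝ) < (q : ℝ) := by
        rw [hq]; exact lt_min (by linarith) (by rw [← heq]; exact hpc1)
      have hle' : (q : ℝ) ≤ p + δ / 2 := by rw [hq]; exact min_le_left _ _
      have hdist : dist q p < δ := by
        rw [Subtype.dist_eq, Real.dist_eq, abs_of_pos (sub_pos.2 hlt')]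
        linarith
      have hnear := hball q hdist
      rw [Real.dist_eq] at hnear
      have hq1 : C * (bondPercolation (zdGraph d) q).real (boxCrossing d L N) < 1 := by
        have := (abs_sub_lt_iff.1 hnear).1
        linarith
      have hθ0 := theta_eq_zero_of_real_boxCrossing_lt q hL hLN hq1
      have hθpos := theta_pos_of_criticalProb_lt_holds (zdGraph d) 0 q (by rw [heq]; exact hlt')
      linarith

/-- **At `p_c` no annulus passes the criterion** (restated): for `d ≥ 2` and all `1 ≤ L ≤ N`,
`1 ≤ 2d (4N/L)^{d-1} · P_{p_c}(Λ(L) ↔ ∂ⁱⁿΛ(N) in Λ(N))`. [cite: Kesten1982, Cor. 5.1] -/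
theorem one_le_criterion_criticalProbI (hd : 2 ≤ d) {L N : ℕ} (hL : 1 ≤ L) (hLN : L ≤ N) :
    1 ≤ 2 * d * (4 * (N : ℝ) / L) ^ (d - 1) *
      (bondPercolation (zdGraph d) (criticalProbI d)).real (boxCrossing d L N) := by
  by_contra hlt
  push Not at hlt
  have h := (lt_criticalProb_iff_exists_real_boxCrossing_lt hd (criticalProbI d)).2 ⟨L, N, hL, hLN, hlt⟩
  rw [coe_criticalProbI] at h
  exact lt_irrefl _ h

end Rsw3

end Summit.CriticalPhenomena.PercolationContinuityZ3.Theorems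

end
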